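import Summits.NavierStokesRegularity.NavierStokesRegularity.Theorems.FilamentSkeletonRssCoreLinearInvertibilityClassClosureToolsB
import Literature.Analysis.FluidPDE.GaussianVortexKernelRadial
import Literature.Analysis.FluidPDE.PineauVicolWeightedIdentity
import Literature.Analysis.FluidPDE.BurgersPhiTemperate

/-!
# Tools for stub `stub_oddSymmetrizerBoundedBelow` (crux `CoreLinearInvertibility`,
# stmt-NavierStokesRegularity-17973, route `FilamentSkeletonRss`, line `Sketch`) — part A:
# the kernel weight `Φ` against the Gaussian weights, and the Gaussian class

Elementary bookkeeping for the transfer of the Gallay–Šverák coercivity of Arnold's quadratic form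
(weight `A = 1/Φ`, `Φ = kerWeight`, `Φ(r) = (r²/4)/(e^{r²/4} − 1)`) to the `X_λ = L²(G_λ⁻¹ dx)` bound
of the odd symmetrizer:

* weight comparisons: `Φ⁻¹(r) ≤ e^{r²/4}`, `Φ(r) ≤ (1 + r²/4) e^{−r²/4}`, and for `0 < λ < 1`
  `Φ(|x|) ≤ (4π/(λ(1−λ))) G_λ(x)` (so `L²(Φ⁻¹) ↪ X_λ` — the place where `λ > 0` is used);
* the GAUSSIAN CLASS `|a(x)| ≤ C (1+|x|)^N e^{−|x|²/4}` (the form printed in the registered stubs):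
  nonnegativity of the constant, sums, scalar multiples, compactly supported functions,
  `x_j e^{−|x|²/4}`, `Φ(|x|) p(x)` for polynomially bounded `p`, reduction to a pure Gaussian bound
  `B e^{−|x|²/8}`;
* integrability for a measurable Gaussian-class `a`: `Φ⁻¹ a²`, `G_λ⁻¹ a²` (`0 ≤ λ < 1`), hence
  `a, x_j a ∈ L¹` (tree: `integrable_and_sq_of_memX`, `integrable_coord_mul_of_memX`).

References: Th. Gallay, V. Šverák, arXiv:2110.13739, §2 (the weight `A`), §4 (4.8) (`A = (eˢ−1)/s`,
`s = r²/4`, for the Gaussian); Th. Gallay, C. E. Wayne, J. Math. Fluid Mech. 9 (2007), proof of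
Prop. 3.1 (the weight `h = Φ`). Everything here is folklore calculus.
-/

set_option linter.dupNamespace false

noncomputable section

namespace Summit.NavierStokesRegularity.NavierStokesRegularity.Theorems

open Set Function Filter MeasureTheory Topology Metric
open Literature.Analysis.FluidPDE

/-! ### The kernel weight against Gaussians -/

/-- `Φ(r)⁻¹ = φ(s) eˢ ≤ eˢ`, `s = r²/4` (`φ = burgersPhi ≤ 1`). [folklore] -/
theorem arnold_inv_kerWeight_le (r : ℝ) : (kerWeight r)⁻¹ ≤ Real.exp (r ^ 2 / 4) := by
  rw [kerWeight, inv_div, Real.exp_neg, div_inv_eq_mul]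
  calc burgersPhi (r ^ 2 / 4) * Real.exp (r ^ 2 / 4) ≤ 1 * Real.exp (r ^ 2 / 4) :=
        mul_le_mul_of_nonneg_right (burgersPhi_le_one (by positivity)) (Real.exp_pos _).le
    _ = Real.exp (r ^ 2 / 4) := one_mul _

/-- `Φ(r) ≤ (1 + r²/4) e^{−r²/4}` (from `1 ≤ (1+s)φ(s)`, tree `one_le_one_add_mul_burgersPhi`). [folklore] -/
theorem arnold_kerWeight_le (r : ℝ) :
    kerWeight r ≤ (1 + r ^ 2 / 4) * Real.exp (-(r ^ 2 / 4)) := by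
  have hs : 0 ≤ r ^ 2 / 4 := by positivity
  have hφ := burgersPhi_pos (r ^ 2 / 4)
  rw [kerWeight, div_le_iff₀ hφ]
  have h1 := one_le_one_add_mul_burgersPhi hs
  nlinarith [Real.exp_pos (-(r ^ 2 / 4))]

/-- **`L²(Φ⁻¹) ↪ X_λ` for `0 < λ < 1`**, pointwise: `Φ(|x|) ≤ (4π/(λ(1−λ))) G_λ(x)`
(`Φ ≤ (1+s)e^{−s}` and `λ(1+s) ≤ e^{λs}`). [folklore] -/
theorem arnold_kerWeight_le_mul_gaussWeightLam {lam : ℝ} (h0 : 0 < lam) (h1 : lam < 1)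
    (x : EuclideanSpace ℝ (Fin 2)) :
    kerWeight ‖x‖ ≤ 4 * Real.pi / (lam * (1 - lam)) * gaussWeightLam lam x := by
  set s : ℝ := ‖x‖ ^ 2 / 4 with hs
  have hs0 : 0 ≤ s := by positivity
  have hΦ := arnold_kerWeight_le ‖x‖
  rw [← hs] at hΦ
  have hG : gaussWeightLam lam x = (1 - lam) / (4 * Real.pi) * Real.exp (-((1 - lam) * s)) := by
    rw [gaussWeightLam, hs]; congr 2; ring
  have hkey : (1 + s) * Real.exp (-s) ≤ lam⁻¹ * Real.exp (-((1 - lam) * s)) := by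
    have h3 : lam * (1 + s) ≤ Real.exp (lam * s) := by
      have := Real.add_one_le_exp (lam * s); nlinarith
    have h4 : Real.exp (-((1 - lam) * s)) = Real.exp (lam * s) * Real.exp (-s) := by
      rw [← Real.exp_add]; congr 1; ring
    rw [h4, ← mul_assoc]
    refine mul_le_mul_of_nonneg_right ?_ (Real.exp_pos _).le
    rw [le_inv_mul_iff₀ h0]
    exact h3
  have hpi : 0 < Real.pi := Real.pi_pos
  have h1' : 0 < 1 - lam := by linarith
  calc kerWeight ‖x‖ ≤ (1 + s) * Real.exp (-s) := hΦ
    _ ≤ lam⁻¹ * Real.exp (-((1 - lam) * s)) := hkey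
    _ = 4 * Real.pi / (lam * (1 - lam)) * gaussWeightLam lam x := by
        rw [hG]; field_simp

/-- The same comparison for the inverse weights: `G_λ⁻¹ ≤ (4π/(λ(1−λ))) Φ⁻¹`. [folklore] -/
theorem arnold_inv_gaussWeightLam_le {lam : ℝ} (h0 : 0 < lam) (h1 : lam < 1)
    (x : EuclideanSpace ℝ (Fin 2)) :
    (gaussWeightLam lam x)⁻¹ ≤ 4 * Real.pi / (lam * (1 - lam)) * (kerWeight ‖x‖)⁻¹ := by
  have hK : 0 < 4 * Real.pi / (lam * (1 - lam)) := by
    have : 0 < 1 - lam := by linarith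
    positivity
  have hG := gaussWeightLam_pos h1 x
  have hΦ := kerWeight_pos ‖x‖
  have h := arnold_kerWeight_le_mul_gaussWeightLam h0 h1 x
  rw [← div_eq_mul_inv, le_div_iff₀ hΦ, inv_mul_le_iff₀ hG]
  linarith

/-! ### The Gaussian class `|a| ≤ C (1+|x|)^N e^{−|x|²/4}` -/

section GaussClass

variable {a b : EuclideanSpace ℝ (Fin 2) → ℝ}

/-- The constant of a Gaussian-class bound is nonnegative (read off at `x = 0`). [folklore] -/
theorem arnold_gc_const_nonneg {C : ℝ} {N : ℕ}
    (h : ∀ x, |a x| ≤ C * (1 + ‖x‖) ^ N * Real.exp (-(‖x‖ ^ 2 / 4))) : 0 ≤ C := by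
  have h0 := h 0
  simp only [norm_zero, add_zero, one_pow, mul_one, ne_eq, OfNat.ofNat_ne_zero,
    not_false_eq_true, zero_pow, zero_div, neg_zero, Real.exp_zero] at h0
  exact (abs_nonneg _).trans h0

/-- Raising the degree of a Gaussian-class bound. [folklore] -/
theorem arnold_gc_mono {C : ℝ} {N M : ℕ} (hNM : N ≤ M)
    (h : ∀ x, |a x| ≤ C * (1 + ‖x‖) ^ N * Real.exp (-(‖x‖ ^ 2 / 4)))
    (x : EuclideanSpace ℝ (Fin 2)) : |a x| ≤ C * (1 + ‖x‖) ^ M * Real.exp (-(‖x‖ ^ 2 / 4)) :=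
  (h x).trans (mul_le_mul_of_nonneg_right
    (mul_le_mul_of_nonneg_left (pow_le_pow_right₀ (by linarith [norm_nonneg x]) hNM)
      (arnold_gc_const_nonneg h)) (Real.exp_pos _).le)

/-- **Sums** of Gaussian-class functions are of Gaussian class. [folklore] -/
theorem arnold_gc_add
    (ha : ∃ (C : ℝ) (N : ℕ), ∀ x, |a x| ≤ C * (1 + ‖x‖) ^ N * Real.exp (-(‖x‖ ^ 2 / 4)))
    (hb : ∃ (C : ℝ) (N : ℕ), ∀ x, |b x| ≤ C * (1 + ‖x‖) ^ N * Real.exp (-(‖x‖ ^ 2 / 4))) :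
    ∃ (C : ℝ) (N : ℕ), ∀ x, |a x + b x| ≤ C * (1 + ‖x‖) ^ N * Real.exp (-(‖x‖ ^ 2 / 4)) := by
  obtain ⟨C, N, hC⟩ := ha
  obtain ⟨D, M, hD⟩ := hb
  refine ⟨C + D, max N M, fun x => ?_⟩
  have h1 := arnold_gc_mono (le_max_left N M) hC x
  have h2 := arnold_gc_mono (le_max_right N M) hD x
  calc |a x + b x| ≤ |a x| + |b x| := abs_add_le _ _
    _ ≤ _ := by rw [add_mul, add_mul]; exact add_le_add h1 h2

/-- **Scalar multiples** of Gaussian-class functions are of Gaussian class. [folklore] -/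
theorem arnold_gc_const_mul (c : ℝ)
    (ha : ∃ (C : ℝ) (N : ℕ), ∀ x, |a x| ≤ C * (1 + ‖x‖) ^ N * Real.exp (-(‖x‖ ^ 2 / 4))) :
    ∃ (C : ℝ) (N : ℕ), ∀ x, |c * a x| ≤ C * (1 + ‖x‖) ^ N * Real.exp (-(‖x‖ ^ 2 / 4)) := by
  obtain ⟨C, N, hC⟩ := ha
  refine ⟨|c| * C, N, fun x => ?_⟩
  rw [abs_mul, mul_assoc, mul_assoc]
  exact mul_le_mul_of_nonneg_left (by rw [← mul_assoc]; exact hC x) (abs_nonneg c)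

/-- **Negatives** of Gaussian-class functions are of Gaussian class. [folklore] -/
theorem arnold_gc_neg
    (ha : ∃ (C : ℝ) (N : ℕ), ∀ x, |a x| ≤ C * (1 + ‖x‖) ^ N * Real.exp (-(‖x‖ ^ 2 / 4))) :
    ∃ (C : ℝ) (N : ℕ), ∀ x, |-a x| ≤ C * (1 + ‖x‖) ^ N * Real.exp (-(‖x‖ ^ 2 / 4)) := by
  simpa only [abs_neg] using ha

/-- **Compactly supported continuous functions are of Gaussian class** (`N = 0`,
`C = ‖a‖_∞ e^{R²/4}` for a support radius `R`). [folklore] -/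
theorem arnold_gc_of_hasCompactSupport (hc : Continuous a) (hs : HasCompactSupport a) :
    ∃ (C : ℝ) (N : ℕ), ∀ x, |a x| ≤ C * (1 + ‖x‖) ^ N * Real.exp (-(‖x‖ ^ 2 / 4)) := by
  obtain ⟨M, hM⟩ := hc.bounded_above_of_compact_support hs
  obtain ⟨R, hR⟩ := hs.isCompact.isBounded.subset_closedBall 0
  have hM0 : 0 ≤ M := (norm_nonneg _).trans (hM 0)
  refine ⟨M * Real.exp (R ^ 2 / 4), 0, fun x => ?_⟩
  rw [pow_zero, mul_one]
  by_cases hx : x ∈ tsupport a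
  · have hxR : ‖x‖ ≤ R := by simpa using hR hx
    have hRpos : 0 ≤ R := (norm_nonneg x).trans hxR
    have h1 : 1 ≤ Real.exp (R ^ 2 / 4) * Real.exp (-(‖x‖ ^ 2 / 4)) := by
      rw [← Real.exp_add]
      exact Real.one_le_exp (by nlinarith [norm_nonneg x])
    calc |a x| = ‖a x‖ := (Real.norm_eq_abs _).symm
      _ ≤ M * 1 := by rw [mul_one]; exact hM x
      _ ≤ M * (Real.exp (R ^ 2 / 4) * Real.exp (-(‖x‖ ^ 2 / 4))) :=
          mul_le_mul_of_nonneg_left h1 hM0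
      _ = _ := by ring
  · rw [image_eq_zero_of_notMem_tsupport hx, abs_zero]
    positivity

/-- `x_j e^{−|x|²/4}` is of Gaussian class (`|x_j| ≤ 1 + |x|`). [folklore] -/
theorem arnold_gc_coord_mul_exp (j : Fin 2) :
    ∃ (C : ℝ) (N : ℕ), ∀ x : EuclideanSpace ℝ (Fin 2),
      |x j * Real.exp (-(‖x‖ ^ 2 / 4))| ≤ C * (1 + ‖x‖) ^ N * Real.exp (-(‖x‖ ^ 2 / 4)) := by
  refine ⟨1, 1, fun x => ?_⟩
  rw [abs_mul, abs_of_pos (Real.exp_pos _), one_mul, pow_one]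
  have hxj : |x j| ≤ ‖x‖ := FourierNS.abs_apply_le_norm x j
  exact mul_le_mul_of_nonneg_right (by linarith) (Real.exp_pos _).le

/-- **`Φ(|x|) p(x)` is of Gaussian class for polynomially bounded `p`**
(`Φ(r) ≤ (1 + r²/4)e^{−r²/4} ≤ (1+r)² e^{−r²/4}`). [folklore] -/
theorem arnold_gc_kerWeight_mul {p : EuclideanSpace ℝ (Fin 2) → ℝ} {A : ℝ} {k : ℕ}
    (hp : ∀ x, |p x| ≤ A * (1 + ‖x‖) ^ k) :
    ∃ (C : ℝ) (N : ℕ), ∀ x : EuclideanSpace ℝ (Fin 2),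
      |kerWeight ‖x‖ * p x| ≤ C * (1 + ‖x‖) ^ N * Real.exp (-(‖x‖ ^ 2 / 4)) := by
  have hA : 0 ≤ A := by
    have := (abs_nonneg _).trans (hp 0); simpa using this
  refine ⟨A, k + 2, fun x => ?_⟩
  rw [abs_mul, abs_of_pos (kerWeight_pos _)]
  have h1 := arnold_kerWeight_le ‖x‖
  have h2 : 1 + ‖x‖ ^ 2 / 4 ≤ (1 + ‖x‖) ^ 2 := by nlinarith [norm_nonneg x]
  have h3 : kerWeight ‖x‖ ≤ (1 + ‖x‖) ^ 2 * Real.exp (-(‖x‖ ^ 2 / 4)) :=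
    h1.trans (mul_le_mul_of_nonneg_right h2 (Real.exp_pos _).le)
  calc kerWeight ‖x‖ * |p x| ≤ ((1 + ‖x‖) ^ 2 * Real.exp (-(‖x‖ ^ 2 / 4))) * (A * (1 + ‖x‖) ^ k) :=
        mul_le_mul h3 (hp x) (abs_nonneg _) (by positivity)
    _ = A * (1 + ‖x‖) ^ (k + 2) * Real.exp (-(‖x‖ ^ 2 / 4)) := by ring

/-- **Reduction to a pure Gaussian bound**: a Gaussian-class function satisfies
`|a| ≤ B e^{−|x|²/8}` (`(1+r)^N e^{−r²/4} ≤ K_N e^{−r²/8}`). [folklore] -/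
theorem arnold_gc_exp_eighth
    (ha : ∃ (C : ℝ) (N : ℕ), ∀ x, |a x| ≤ C * (1 + ‖x‖) ^ N * Real.exp (-(‖x‖ ^ 2 / 4))) :
    ∃ B : ℝ, 0 ≤ B ∧ ∀ x, |a x| ≤ B * Real.exp (-(1 / 8) * ‖x‖ ^ 2) := by
  obtain ⟨C, N, hC⟩ := ha
  have hC0 := arnold_gc_const_nonneg hC
  refine ⟨C * (N.factorial * (4 / (1 / 4)) ^ N * Real.exp ((1 / 4) / 2)), by positivity, fun x => ?_⟩
  have h := PineauVicol2026.one_add_pow_mul_exp_neg_mul_sq_le (c := 1 / 4) (by norm_num) N (norm_nonneg x)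
  have e1 : -(1 / 4 : ℝ) * ‖x‖ ^ 2 = -(‖x‖ ^ 2 / 4) := by ring
  have e2 : -((1 / 4 : ℝ) / 2) * ‖x‖ ^ 2 = -(1 / 8) * ‖x‖ ^ 2 := by ring
  rw [e1, e2] at h
  calc |a x| ≤ C * ((1 + ‖x‖) ^ N * Real.exp (-(‖x‖ ^ 2 / 4))) := by rw [← mul_assoc]; exact hC x
    _ ≤ C * ((N.factorial * (4 / (1 / 4)) ^ N * Real.exp ((1 / 4) / 2)) * Real.exp (-(1 / 8) * ‖x‖ ^ 2)) :=
        mul_le_mul_of_nonneg_left h hC0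
    _ = _ := by ring

/-! ### Integrability of the weighted squares of a Gaussian-class function -/

/-- **`Φ⁻¹ a² ∈ L¹`** for a measurable Gaussian-class `a` (`Φ⁻¹ ≤ e^{r²/4}`, so
`Φ⁻¹a² ≤ C²(1+r)^{2N} e^{−r²/4}`). [folklore] -/
theorem arnold_integrable_inv_kerWeight_mul_sq (ham : AEStronglyMeasurable a volume)
    (ha : ∃ (C : ℝ) (N : ℕ), ∀ x, |a x| ≤ C * (1 + ‖x‖) ^ N * Real.exp (-(‖x‖ ^ 2 / 4))) :
    Integrable fun x => (kerWeight ‖x‖)⁻¹ * a x ^ 2 := by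
  obtain ⟨C, N, hC⟩ := ha
  have hC0 := arnold_gc_const_nonneg hC
  have hint := (PineauVicol2026.integrable_one_add_norm_pow_mul_exp_neg_mul_sq
    (E := EuclideanSpace ℝ (Fin 2)) (c := 1 / 4) (by norm_num) (2 * N)).const_mul (C ^ 2)
  refine hint.mono' (((continuous_kerWeight.comp continuous_norm).inv₀
      fun x => (kerWeight_pos _).ne').aestronglyMeasurable.mul (ham.pow 2))
    (Eventually.of_forall fun x => ?_)
  have hΦ := kerWeight_pos ‖x‖
  rw [Real.norm_of_nonneg (by positivity)]
  have h1 := arnold_inv_kerWeight_le ‖x‖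
  have h2 : a x ^ 2 ≤ (C * (1 + ‖x‖) ^ N * Real.exp (-(‖x‖ ^ 2 / 4))) ^ 2 := by
    rw [← sq_abs]; exact pow_le_pow_left₀ (abs_nonneg _) (hC x) 2
  have h3 : Real.exp (‖x‖ ^ 2 / 4) * Real.exp (-(‖x‖ ^ 2 / 4)) ^ 2 = Real.exp (-(1 / 4) * ‖x‖ ^ 2) := by
    rw [pow_two (Real.exp _), ← Real.exp_add, ← Real.exp_add]; congr 1; ring
  calc (kerWeight ‖x‖)⁻¹ * a x ^ 2
      ≤ Real.exp (‖x‖ ^ 2 / 4) * (C * (1 + ‖x‖) ^ N * Real.exp (-(‖x‖ ^ 2 / 4))) ^ 2 :=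
        mul_le_mul h1 h2 (sq_nonneg _) (Real.exp_pos _).le
    _ = C ^ 2 * ((1 + ‖x‖) ^ (2 * N) * Real.exp (-(1 / 4) * ‖x‖ ^ 2)) := by
        rw [← h3]; ring

/-- **`G_λ⁻¹ a² ∈ L¹`** for a measurable Gaussian-class `a` and `0 ≤ λ < 1`
(`G_λ⁻¹ a² ≤ (4πC²/(1−λ)) (1+r)^{2N} e^{−(1+λ)r²/4}`). [folklore] -/
theorem arnold_integrable_inv_gaussWeightLam_mul_sq {lam : ℝ} (h0 : 0 ≤ lam) (h1 : lam < 1)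
    (ham : AEStronglyMeasurable a volume)
    (ha : ∃ (C : ℝ) (N : ℕ), ∀ x, |a x| ≤ C * (1 + ‖x‖) ^ N * Real.exp (-(‖x‖ ^ 2 / 4))) :
    Integrable fun x => (gaussWeightLam lam x)⁻¹ * a x ^ 2 := by
  obtain ⟨C, N, hC⟩ := ha
  have hC0 := arnold_gc_const_nonneg hC
  have hl : 0 < 1 - lam := by linarith
  have hint := (PineauVicol2026.integrable_one_add_norm_pow_mul_exp_neg_mul_sq
    (E := EuclideanSpace ℝ (Fin 2)) (c := 1 / 4) (by norm_num) (2 * N)).const_mul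
    (4 * Real.pi / (1 - lam) * C ^ 2)
  refine hint.mono' ((continuous_inv_gaussWeightLam h1).aestronglyMeasurable.mul (ham.pow 2))
    (Eventually.of_forall fun x => ?_)
  have hG := gaussWeightLam_pos h1 x
  rw [Real.norm_of_nonneg (by positivity)]
  have h2 : a x ^ 2 ≤ (C * (1 + ‖x‖) ^ N * Real.exp (-(‖x‖ ^ 2 / 4))) ^ 2 := by
    rw [← sq_abs]; exact pow_le_pow_left₀ (abs_nonneg _) (hC x) 2
  have hGinv : (gaussWeightLam lam x)⁻¹ = 4 * Real.pi / (1 - lam) * Real.exp ((1 - lam) / 4 * ‖x‖ ^ 2) := by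
    rw [gaussWeightLam, mul_inv, Real.exp_neg, inv_inv, inv_div]
  have h3 : Real.exp ((1 - lam) / 4 * ‖x‖ ^ 2) * Real.exp (-(‖x‖ ^ 2 / 4)) ^ 2 ≤
      Real.exp (-(1 / 4) * ‖x‖ ^ 2) := by
    rw [pow_two (Real.exp _), ← Real.exp_add, ← Real.exp_add, Real.exp_le_exp]
    nlinarith [sq_nonneg ‖x‖]
  calc (gaussWeightLam lam x)⁻¹ * a x ^ 2
      ≤ (gaussWeightLam lam x)⁻¹ * (C * (1 + ‖x‖) ^ N * Real.exp (-(‖x‖ ^ 2 / 4))) ^ 2 :=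
        mul_le_mul_of_nonneg_left h2 (inv_nonneg.2 hG.le)
    _ = 4 * Real.pi / (1 - lam) * C ^ 2 * ((1 + ‖x‖) ^ (2 * N) *
          (Real.exp ((1 - lam) / 4 * ‖x‖ ^ 2) * Real.exp (-(‖x‖ ^ 2 / 4)) ^ 2)) := by
        rw [hGinv]; ring
    _ ≤ 4 * Real.pi / (1 - lam) * C ^ 2 * ((1 + ‖x‖) ^ (2 * N) * Real.exp (-(1 / 4) * ‖x‖ ^ 2)) := by
        gcongr

/-- A measurable Gaussian-class function and its first moments are integrable (through
`X_{1/2} ⊆ L¹`, tree `integrable_and_sq_of_memX`, `integrable_coord_mul_of_memX`). [folklore] -/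
theorem arnold_integrable_of_gc (ham : AEStronglyMeasurable a volume)
    (ha : ∃ (C : ℝ) (N : ℕ), ∀ x, |a x| ≤ C * (1 + ‖x‖) ^ N * Real.exp (-(‖x‖ ^ 2 / 4))) :
    Integrable a ∧ (Integrable fun x => a x ^ 2) ∧
      ∀ j : Fin 2, Integrable fun x : EuclideanSpace ℝ (Fin 2) => x j * a x := by
  have hX := arnold_integrable_inv_gaussWeightLam_mul_sq (lam := 1 / 2) (by norm_num) (by norm_num) ham ha
  obtain ⟨h1, h2⟩ := integrable_and_sq_of_memX (lam := 1 / 2) (by norm_num) ham hX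
  exact ⟨h1, h2, fun j => integrable_coord_mul_of_memX (lam := 1 / 2) (by norm_num) ham hX j⟩

end GaussClass

/-! ### The registered tools stub -/

/-- **Registered tools stub `stub_oddArnoldToolsA`** (helpers for `stub_oddSymmetrizerBoundedBelow`, line
`Sketch` of crux `CoreLinearInvertibility`, stmt-NavierStokesRegularity-17973): the weight comparisons
`Φ⁻¹ ≤ e^{r²/4}`, `Φ ≤ (1 + r²/4)e^{−r²/4}`, `G_λ⁻¹ ≤ (4π/(λ(1−λ))) Φ⁻¹` (`0 < λ < 1`), and the
integrability of `Φ⁻¹a²`, `G_λ⁻¹a²`, `a`, `x_j a` for a measurable Gaussian-class `a`. [folklore] -/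
theorem stub_oddArnoldToolsA :
    (∀ r : ℝ, (kerWeight r)⁻¹ ≤ Real.exp (r ^ 2 / 4)) ∧
    (∀ r : ℝ, kerWeight r ≤ (1 + r ^ 2 / 4) * Real.exp (-(r ^ 2 / 4))) ∧
    (∀ (lam : ℝ) (x : EuclideanSpace ℝ (Fin 2)), 0 < lam → lam < 1 →
      (gaussWeightLam lam x)⁻¹ ≤ 4 * Real.pi / (lam * (1 - lam)) * (kerWeight ‖x‖)⁻¹) ∧
    (∀ (lam : ℝ) (a : EuclideanSpace ℝ (Fin 2) → ℝ), 0 ≤ lam → lam < 1 →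
      AEStronglyMeasurable a volume →
      (∃ (C : ℝ) (N : ℕ), ∀ x, |a x| ≤ C * (1 + ‖x‖) ^ N * Real.exp (-(‖x‖ ^ 2 / 4))) →
      Integrable (fun x => (kerWeight ‖x‖)⁻¹ * a x ^ 2) ∧
      Integrable (fun x => (gaussWeightLam lam x)⁻¹ * a x ^ 2) ∧ Integrable a ∧
      ∀ j : Fin 2, Integrable (fun x : EuclideanSpace ℝ (Fin 2) => x j * a x)) :=
  ⟨arnold_inv_kerWeight_le, arnold_kerWeight_le, fun _ x h0 h1 => arnold_inv_gaussWeightLam_le h0 h1 x,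
    fun _ _ h0 h1 ham ha => ⟨arnold_integrable_inv_kerWeight_mul_sq ham ha,
      arnold_integrable_inv_gaussWeightLam_mul_sq h0 h1 ham ha, (arnold_integrable_of_gc ham ha).1,
      (arnold_integrable_of_gc ham ha).2.2⟩⟩

end Summit.NavierStokesRegularity.NavierStokesRegularity.Theorems
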